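import Summits.Ventures.PercRepro.RankLevelSetExplicitArithB
import Summits.Ventures.PercRepro.RankLevelSetFrameLarge
import Summits.Ventures.PercRepro.RankLevelSetCoreGeneral
import Summits.Ventures.PercRepro.RankLevelSetLocalSparse
import Summits.Ventures.PercRepro.RankLevelSetDepCountGen
import Summits.Ventures.PercRepro.RankLevelSetCircuitCount
import Summits.Ventures.PercRepro.RankLevelSetLevelFiveArithA
import Summits.Ventures.PercRepro.RankLevelSetFrameQM
import Summits.Ventures.PercRepro.SevenThreeQThree
import Summits.Ventures.PercRepro.RankLevelSetPlaneSix
import Summits.Ventures.PercRepro.RankLevelSetTheoremCFull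
import Summits.Ventures.PercRepro.RankLevelSetFiniteReduction

/-!
# PercRepro — THEOREM P: C-025 at EVERY level `q ≥ 3` for every finite matroid and every `p ≥ Pexp q`, with an
EXPLICIT threshold (p9, sub-claim S4 of the crux `C025`; `proofs/SUBCLAIM-S4-p9.md`)

Theorem C∞ (`exists_P_c025_all_corank`, RankLevelSetFrameLarge) gives, at every level `q ≥ 2`, C-025 for all
`p ≥ P(q)` with `P(q)` EXISTENTIAL. Here `P(q)` is made explicit at every level: `Pexp 3 = 5` (the `q = 3` row
`SevenThree.c025_three_all`), `Pexp (q+1) = max (Pexp q) (Tcore (q+1)) + 1` with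
`Tcore q = 2^{2^{q−1}+q+4}·q²` (`RankLevelSetExplicitArithB`), so `Pexp q ≤ 2^{2^{q−1}+q+4}·q² + 1` for `q ≥ 4`
(`Pexp_le_Tcore_succ`). The level step is night-1's wrapper `rls_succ_large q (q+1) P` with corank `≤ q + 1`
free (`RLS_of_ncard_lt` / Theorem M `RLS_of_ncard_eq`) and the `e`-free core at level `q + 1` in two regimes:
bounded corank `q' + 1 ≤ d ≤ q' + 2^{q'}` by the general count `ncard_eRk_eq_ncard_le_le` with the local-sparsity
flat bound `2^{q'} − 1`, the circuit counts `ncard_circuits_le_choose_of_encard`, the tail of part A and the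
polynomial inequality `poly_main` (`c025_core_explicit_bounded`); corank `≥ q' + 2^{q'} + 1` by
`core_all_corank_of_thresholds_of_bound q' (2^{q'} − 1)` with the explicit thresholds `N₁`, `P₂` of part A
(`c025_core_explicit_large`).

* **`c025_explicit_all`** — `∀ q ≥ 3, ∀ M [M.Finite] p, Pexp q ≤ p → RLS M p q`;
* `c025_explicit_all'` — the same in the literal `C025` body; `c025_explicit_seven_up` — the `q ≥ 7` rows of S4;
* **`finite_cells_level_succ_explicit`** — night-1's «every level is a finite problem modulo the level below»
  (`exists_finite_cells_level_succ`, existential `P`, `N`) made EXPLICIT: level `q + 1` for every `p ≥ q + 3` follows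
  from level `q` and the simple, coloop-free, `e`-free core cells `(p, n)` with `q + 3 ≤ p < Pexp (q+1)` and
  `n < Nexp p (q+1)`, `Nexp` the tree's fixed-rank core threshold (`core_fixed_rank_of_le`, d?) — finitely many
  matroids up to isomorphism, with explicit bounds at every level.
The bound is crude (`Pexp 4 = 1,048,577` against the typed `60`; `Pexp 7 ≈ 1.85·10^24`) but UNIFORM: one kernel
theorem at every level, no existential constant. Axioms: standard.
-/

open scoped Matroid

namespace PercRepro

namespace ThmN

open Set

variable {α : Type}

/-- **The `e`-free core at level `q ≥ 3`, bounded corank `q + 1 ≤ d ≤ q + 2^q`, rank `p ≥ Tcore q`**: the general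
count `ncard_eRk_eq_ncard_le_le` with the flat bound `f = 2^q − 1` (local sparsity), the circuit counts
`s_k ≤ C(d+k−1, k) ≤ 2^{d+q}`, the tail `16·Σ_{j ≤ q+2^q} C(n, j) ≤ 2^n`, and the polynomial inequality
`Explicit.poly_main`. -/
theorem c025_core_explicit_bounded (q : ℕ) (hq : 3 ≤ q) (M : Matroid α) [M.Finite] (p d : ℕ)
    (hp : Explicit.Tcore q ≤ p) (hd1 : q + 1 ≤ d) (hd2 : d ≤ q + 2 ^ q)
    (hR : M.eRank = (p : ℕ∞)) (hn : M.E.ncard = p + d)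
    (hfree : ∀ e ∈ M.E, ∃ A ⊆ M.E \ {e}, e ∉ M.closure A ∧ e ∉ M.closure ((M.E \ {e}) \ A)) :
    RLS M p q := by
  classical
  obtain ⟨m, rfl⟩ : ∃ m, d = q + 1 + m := ⟨d - (q + 1), by omega⟩
  obtain ⟨hN₁, hP₂, h2q, h16, htail⟩ := Explicit.Tcore_bounds q hq
  have hq1 := Explicit.succ_le_two_pow q
  have hEcard : M.ground_finite.toFinset.card = p + (q + 1 + m) := by
    rw [← Set.ncard_eq_toFinset_card _ M.ground_finite]; exact hn
  -- the core is simple: every circuit has `≥ 3` elements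
  have hL : ∀ e ∈ M.E, ¬ M.IsLoop e := not_isLoop_of_free M hfree
  have hs : ∀ e ∈ M.E, ∀ f ∈ M.E, e ≠ f → M.eRk {e, f} = 2 := by
    intro e he f hf hef
    have h2 : (2 : ℕ∞) ≤ M.eRk {e, f} :=
      two_le_eRk_of_two_le_ncard_of_free M hfree (pair_subset he hf) (by rw [ncard_pair hef])
    have h3 : M.eRk {e, f} ≤ 2 := by
      have := M.eRk_le_encard {e, f}
      rwa [encard_pair hef] at this
    exact le_antisymm h3 h2
  have hcirc : ∀ C, M.IsCircuit C → 3 ≤ C.encard := three_le_encard_of_circuit M hL hs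
  -- rank-`≤ q` sets have `≤ 2^q − 1` points (local sparsity)
  have hflat : ∀ X ⊆ M.E, M.eRk X ≤ q → X.ncard ≤ 2 ^ q - 1 := by
    intro X hX hr
    have := ncard_add_one_le_two_pow_of_eRk_le M hL hfree q X hX hr
    omega
  have hd : M.E.encard = M.eRank + ((q + 1 + m : ℕ) : ℕ∞) := by
    rw [hR, ← M.ground_finite.cast_ncard_eq, hn]
    push_cast
    ring
  -- (U)
  have hU1 := Matroid.topCount_le_ncard_compl (M := M) hR hd q
  have hU2 := Matroid.ncard_eRk_eq_ncard_le_le M q (2 ^ q - 1) hcirc hflat (q + 1 + m)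
  rw [hn] at hU2
  -- `σ ≤ 2^{2^q − q − 2}`
  have hσ : ∑ j ∈ Finset.range (q + 1 + m - (q + 1) + 1), Nat.choose (2 ^ q - 1 - (q + 1)) j ≤
      2 ^ (2 ^ q - q - 2) := by
    have := Explicit.sum_range_choose_le_two_pow (2 ^ q - 1 - (q + 1)) (q + 1 + m - (q + 1) + 1)
    rw [show 2 ^ q - 1 - (q + 1) = 2 ^ q - q - 2 by omega] at this
    rw [show 2 ^ q - 1 - (q + 1) = 2 ^ q - q - 2 by omega]
    exact this
  -- the circuit sum: `Σ_k s_k·C(n, q+1−k) ≤ (q−1)·2^{d+q}·C(n, q−2)`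
  have hhalf : q - 2 ≤ (p + (q + 1 + m)) / 2 := by omega
  have hsum : ∑ k ∈ Finset.Icc 3 (q + 1),
      {C | M.IsCircuit C ∧ C.ncard = k}.ncard * (p + (q + 1 + m)).choose (q + 1 - k) ≤
        (q - 1) * (2 ^ (2 * q + 1 + m) * (p + (q + 1 + m)).choose (q - 2)) := by
    calc ∑ k ∈ Finset.Icc 3 (q + 1),
          {C | M.IsCircuit C ∧ C.ncard = k}.ncard * (p + (q + 1 + m)).choose (q + 1 - k)
        ≤ ∑ _k ∈ Finset.Icc 3 (q + 1), 2 ^ (2 * q + 1 + m) * (p + (q + 1 + m)).choose (q - 2) := by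
          apply Finset.sum_le_sum
          intro k hk
          rw [Finset.mem_Icc] at hk
          have hc : {C | M.IsCircuit C ∧ C.ncard = k}.ncard ≤ (q + 1 + m + (k - 1)).choose k := by
            have := Matroid.ncard_circuits_le_choose_of_encard M hd (k - 1)
            rw [show k - 1 + 1 = k by omega] at this
            exact this
          have hc2 : (q + 1 + m + (k - 1)).choose k ≤ 2 ^ (2 * q + 1 + m) :=
            (Nat.choose_le_two_pow _ _).trans (Nat.pow_le_pow_right (by norm_num) (by omega))
          have hmono : (p + (q + 1 + m)).choose (q + 1 - k) ≤ (p + (q + 1 + m)).choose (q - 2) :=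
            Explicit.choose_le_choose_of_le_half _ _ _ (by omega) hhalf
          exact Nat.mul_le_mul (hc.trans hc2) hmono
      _ = (q - 1) * (2 ^ (2 * q + 1 + m) * (p + (q + 1 + m)).choose (q - 2)) := by
          rw [Finset.sum_const, Nat.card_Icc, smul_eq_mul]
          congr 1
  -- the `N`-term
  set N : ℕ := (∑ j ∈ Finset.range (q + 1 + m - (q + 1) + 1), Nat.choose (2 ^ q - 1 - (q + 1)) j) *
    ∑ k ∈ Finset.Icc 3 (q + 1),
      {C | M.IsCircuit C ∧ C.ncard = k}.ncard * (p + (q + 1 + m)).choose (q + 1 - k) with hNdef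
  have hN : N ≤ 2 ^ (2 ^ q - q - 2) * (q - 1) * 2 ^ (2 * q + 1 + m) * (p + q + 1 + m).choose (q - 2) := by
    rw [show p + q + 1 + m = p + (q + 1 + m) by ring]
    calc N ≤ 2 ^ (2 ^ q - q - 2) * ((q - 1) * (2 ^ (2 * q + 1 + m) * (p + (q + 1 + m)).choose (q - 2))) :=
          Nat.mul_le_mul hσ hsum
      _ = _ := by ring
  have hU : Matroid.topCount M p q ≤ (p + (q + 1 + m)).choose q + N := hU1.trans hU2
  -- (Y)
  have hY := Matroid.two_pow_le_midCount_add (M := M) p q hR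
  have hA : {X : Set α | X ⊆ M.E ∧ M.eRk X ≤ q}.ncard ≤
      ∑ j ∈ Finset.range (2 ^ q - 1 + 1), (p + (q + 1 + m)).choose j := by
    calc {X : Set α | X ⊆ M.E ∧ M.eRk X ≤ q}.ncard
        ≤ {X : Set α | X ⊆ (M.ground_finite.toFinset : Set α) ∧ X.ncard ≤ 2 ^ q - 1}.ncard := by
          apply ncard_le_ncard
          · intro X hX
            exact ⟨by rw [Set.Finite.coe_toFinset]; exact hX.1, hflat X hX.1 hX.2⟩
          · exact (Finset.finite_toSet _).finite_subsets.subset (fun X hX => hX.1)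
      _ ≤ ∑ j ∈ Finset.range (2 ^ q - 1 + 1), M.ground_finite.toFinset.card.choose j :=
          ncard_subsets_ncard_le _ (2 ^ q - 1)
      _ = ∑ j ∈ Finset.range (2 ^ q - 1 + 1), (p + (q + 1 + m)).choose j := by rw [hEcard]
  have hB := Matroid.ncard_spanning_le (M := M) hd
  rw [hEcard] at hY hB
  -- the tail with `K = q + 2^q`
  have hT : 16 * ∑ j ∈ Finset.range (q + 2 ^ q + 1), (p + (q + 1 + m)).choose j ≤ 2 ^ (p + (q + 1 + m)) :=
    Explicit.sixteen_mul_sum_range_choose_le (q + 2 ^ q) (p + (q + 1 + m)) (by omega)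
  have hA' : ∑ j ∈ Finset.range (2 ^ q - 1 + 1), (p + (q + 1 + m)).choose j ≤
      ∑ j ∈ Finset.range (q + 2 ^ q + 1), (p + (q + 1 + m)).choose j :=
    Finset.sum_le_sum_of_subset_of_nonneg (Finset.range_mono (by omega)) (fun _ _ _ => Nat.zero_le _)
  have hB' : ∑ j ∈ Finset.range (q + 1 + m + 1), (p + (q + 1 + m)).choose j ≤
      ∑ j ∈ Finset.range (q + 2 ^ q + 1), (p + (q + 1 + m)).choose j :=
    Finset.sum_le_sum_of_subset_of_nonneg (Finset.range_mono (by omega)) (fun _ _ _ => Nat.zero_le _)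
  have hAB : 8 * ({X : Set α | X ⊆ M.E ∧ M.eRk X ≤ q}.ncard +
      {X : Set α | X ⊆ M.E ∧ M.eRk X = M.eRank}.ncard) ≤ 2 ^ (p + (q + 1 + m)) := by
    have h1 := hA.trans hA'
    have h2 := hB.trans hB'
    omega
  -- (Φ) and the polynomial inequality
  have hΦ := phiK_le_two_pow_div p q
  rw [Nat.choose_symm_add] at hΦ
  have hpoly := Explicit.poly_main q m p N hq (by omega) hp hN
  rw [show p + q + 1 + m = p + (q + 1 + m) by ring] at hpoly
  -- assemble in `ℚ`
  rw [RLS_iff]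
  have hUq : (Matroid.topCount M p q : ℚ) ≤ ((p + (q + 1 + m)).choose q : ℚ) + (N : ℚ) := by
    exact_mod_cast hU
  have hYq : (2 : ℚ) ^ (p + (q + 1 + m)) ≤ (Matroid.midCount M p q : ℚ) +
      ({X : Set α | X ⊆ M.E ∧ M.eRk X ≤ q}.ncard : ℚ) +
      ({X : Set α | X ⊆ M.E ∧ M.eRk X = M.eRank}.ncard : ℚ) := by exact_mod_cast hY
  have hABq : 8 * (({X : Set α | X ⊆ M.E ∧ M.eRk X ≤ q}.ncard : ℚ) +
      ({X : Set α | X ⊆ M.E ∧ M.eRk X = M.eRank}.ncard : ℚ)) ≤ 2 ^ (p + (q + 1 + m)) := by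
    exact_mod_cast hAB
  have hpolyq : 8 * (((p + (q + 1 + m)).choose q : ℚ) + (N : ℚ)) ≤
      7 * 2 ^ (q + 1 + m - q) * ((p + q).choose q : ℚ) := by
    rw [show q + 1 + m - q = m + 1 by omega]
    exact_mod_cast hpoly
  have hU0 : (0 : ℚ) ≤ (Matroid.topCount M p q : ℚ) := Nat.cast_nonneg _
  exact level_arith (p := p) (d := q + 1 + m) (n := p + (q + 1 + m)) (q := q) rfl (by omega) hΦ hU0 hUq hYq
    hABq hpolyq

/-- **The `e`-free core at level `q ≥ 3`, corank `≥ q + 2^q + 1`, rank `p ≥ Tcore q`** — night-1's core theorem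
`core_all_corank_of_thresholds_of_bound` with `B = 2^q − 1` and the explicit regime thresholds `N₁ q`, `P₂ q`. -/
theorem c025_core_explicit_large (q : ℕ) (hq : 3 ≤ q) (M : Matroid α) [M.Finite] (p : ℕ)
    (hp : Explicit.Tcore q ≤ p) (hR : M.eRank = (p : ℕ∞)) (hbig : p + q + 2 ^ q < M.E.ncard)
    (hfree : ∀ e ∈ M.E, ∃ A ⊆ M.E \ {e}, e ∉ M.closure A ∧ e ∉ M.closure ((M.E \ {e}) \ A)) :
    RLS M p q := by
  obtain ⟨hN₁, hP₂, h2q, -, -⟩ := Explicit.Tcore_bounds q hq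
  have hq1 := Explicit.succ_le_two_pow q
  refine core_all_corank_of_thresholds_of_bound q (2 ^ q - 1) (by omega) (by omega)
    (2 ^ (q + 1) + 2 * q ^ 2 + 4 * q + 4) (2 ^ (q + 1) + 3 * q + 2) (fun n hn => Explicit.regime_one q n hn)
    (fun p' hp' => Explicit.regime_two q (by omega) p' hp') M p ?_ hR ?_ hfree ?_
  · exact (max_le (max_le hN₁ hP₂) h2q).trans hp
  · omega
  · intro j hj X hX hr
    have hL := not_isLoop_of_free M hfree
    have h1 := ncard_add_one_le_two_pow_of_eRk_le M hL hfree j X hX hr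
    have h2 := Explicit.two_pow_add_le_two_pow_add j q hj
    omega

/-- **The level step with an explicit threshold**: level `q` for all `p ≥ P` and `P ≥ Tcore (q+1)` give level
`q + 1` for all `p ≥ P + 1` (`rls_succ_large` with `D = q + 1`: corank `≤ q + 1` is `U = ∅` / Theorem M, the
core is `c025_core_explicit_bounded` / `c025_core_explicit_large` at level `q + 1`). -/
theorem c025_succ_explicit (q : ℕ) (hq : 3 ≤ q) (P : ℕ) (hP : Explicit.Tcore (q + 1) ≤ P)
    (hprev : ∀ (M : Matroid α) [M.Finite] (p : ℕ), P ≤ p → q + 2 ≤ p → RLS M p q) :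
    ∀ (M : Matroid α) [M.Finite] (p : ℕ), P + 1 ≤ p → RLS M p (q + 1) := by
  intro M _ p hp
  have hq3 : q + 3 ≤ Explicit.Tcore (q + 1) := by
    obtain ⟨-, -, h, -, -⟩ := Explicit.Tcore_bounds (q + 1) (by omega)
    have := Explicit.succ_le_two_pow (q + 1)
    omega
  refine rls_succ_large (α := α) q (q + 1) P hprev ?_ ?_ M p hp (by omega)
  · -- corank `≤ q + 1`: `U = ∅` or Theorem M
    intro M' _ p' _ hn _
    rcases Nat.lt_or_ge M'.E.ncard (p' + (q + 1)) with h | h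
    · exact RLS_of_ncard_lt M' h
    · exact RLS_of_ncard_eq M' (by omega)
  · -- the core at level `q + 1`
    intro M' _ p' hP' hR hbig _ hfree
    rcases Nat.lt_or_ge M'.E.ncard (p' + (q + 1) + 2 ^ (q + 1) + 1) with h | h
    · exact c025_core_explicit_bounded (q + 1) (by omega) M' p' (M'.E.ncard - p') (hP.trans hP')
        (by omega) (by omega) hR (by omega) hfree
    · exact c025_core_explicit_large (q + 1) (by omega) M' p' (hP.trans hP') hR (by omega) hfree

/-- **THE EXPLICIT THRESHOLD SEQUENCE** `Pexp`: `Pexp 3 = 5` (the `q = 3` row), and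
`Pexp (q+1) = max (Pexp q) (Tcore (q+1)) + 1` for `q ≥ 3`. -/
def Pexp : ℕ → ℕ
  | 0 => 5
  | 1 => 5
  | 2 => 5
  | 3 => 5
  | q + 4 => max (Pexp (q + 3)) (Explicit.Tcore (q + 4)) + 1

/-- The recursion of `Pexp` at `q ≥ 3`. -/
theorem Pexp_succ (q : ℕ) (hq : 3 ≤ q) : Pexp (q + 1) = max (Pexp q) (Explicit.Tcore (q + 1)) + 1 := by
  obtain ⟨k, rfl⟩ : ∃ k, q = k + 3 := ⟨q - 3, by omega⟩
  rfl

/-- **THEOREM P — C-025 AT EVERY LEVEL `q ≥ 3` FOR EVERY FINITE MATROID AND EVERY `p ≥ Pexp q`**, with the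
EXPLICIT threshold `Pexp` (induction on `q` from the `q = 3` row `SevenThree.c025_three_all` through
`c025_succ_explicit`). -/
theorem c025_explicit_all (q : ℕ) (hq : 3 ≤ q) :
    ∀ (M : Matroid α) [M.Finite] (p : ℕ), Pexp q ≤ p → RLS M p q := by
  induction q, hq using Nat.le_induction with
  | base =>
    intro M _ p hp
    exact SevenThree.c025_three_all M p hp
  | succ q hq ih =>
    intro M _ p hp
    rw [Pexp_succ q hq] at hp
    refine c025_succ_explicit q hq (max (Pexp q) (Explicit.Tcore (q + 1))) (le_max_right _ _) ?_ M p hp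
    intro M' _ p' hP' _
    exact ih M' p' ((le_max_left _ _).trans hP')

/-- THEOREM P in the literal `C025` body at `(p, q)`. -/
theorem c025_explicit_all' (q : ℕ) (hq : 3 ≤ q) (M : Matroid α) [M.Finite] (p : ℕ) (hp : Pexp q ≤ p) :
    phiK p q * ({A : Set α | A ⊆ M.E ∧ M.eRk A = (p : ℕ∞) ∧ M.eRk (M.E \ A) = (q : ℕ∞)}.ncard : ℚ) ≤
      ({A : Set α | A ⊆ M.E ∧ (q : ℕ∞) < M.eRk A ∧ M.eRk A < (p : ℕ∞)}.ncard : ℚ) :=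
  c025_explicit_all q hq M p hp

/-- `Tcore` grows: `2·Tcore q ≤ Tcore (q + 1)` for `q ≥ 1`. -/
theorem Tcore_le_Tcore_succ (q : ℕ) (hq : 1 ≤ q) : 2 * Explicit.Tcore q ≤ Explicit.Tcore (q + 1) := by
  unfold Explicit.Tcore
  have h1 : 2 ^ (q - 1) ≤ 2 ^ (q + 1 - 1) := Nat.pow_le_pow_right (by norm_num) (by omega)
  have h2 : 2 ^ (2 ^ (q - 1) + q + 4 + 1) ≤ 2 ^ (2 ^ (q + 1 - 1) + (q + 1) + 4) :=
    Nat.pow_le_pow_right (by norm_num) (by omega)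
  have h3 : q ^ 2 ≤ (q + 1) ^ 2 := Nat.pow_le_pow_left (by omega) 2
  calc 2 * (2 ^ (2 ^ (q - 1) + q + 4) * q ^ 2) = 2 ^ (2 ^ (q - 1) + q + 4 + 1) * q ^ 2 := by ring
    _ ≤ 2 ^ (2 ^ (q + 1 - 1) + (q + 1) + 4) * (q + 1) ^ 2 := Nat.mul_le_mul h2 h3

/-- **THE CLOSED FORM**: `Pexp q ≤ Tcore q + 1 = 2^{2^{q−1}+q+4}·q² + 1` for every `q ≥ 4`. -/
theorem Pexp_le_Tcore_succ (q : ℕ) (hq : 4 ≤ q) : Pexp q ≤ Explicit.Tcore q + 1 := by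
  induction q, hq using Nat.le_induction with
  | base =>
    show max (Pexp 3) (Explicit.Tcore 4) + 1 ≤ Explicit.Tcore 4 + 1
    have : Pexp 3 ≤ Explicit.Tcore 4 := by
      show 5 ≤ Explicit.Tcore 4
      unfold Explicit.Tcore; norm_num
    omega
  | succ q hq ih =>
    rw [Pexp_succ q (by omega)]
    have h := Tcore_le_Tcore_succ q (by omega)
    have hpos : 1 ≤ Explicit.Tcore q := by
      have h1 : 1 ≤ q ^ 2 := Nat.one_le_pow _ _ (by omega)
      have h2 : 1 ≤ 2 ^ (q + 4) := Nat.one_le_two_pow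
      have h3 := Explicit.two_pow_mul_sq_le_Tcore q
      have h4 := Nat.mul_le_mul h2 h1
      omega
    have : max (Pexp q) (Explicit.Tcore (q + 1)) ≤ Explicit.Tcore (q + 1) := max_le (by omega) le_rfl
    omega

/-- The fixed-rank core threshold of `core_fixed_rank_of_le` (night-1 g3, RankLevelSetFiniteReduction) as a function:
`Nexp p q = q + a + a!·(2^{p+q}·2^{2^q−1} + (q+1)·2^{2^q−1})·C(p−1, q) + 2p`, `a = p − 1 − q`. -/
def Nexp (p q : ℕ) : ℕ :=
  q + (p - 1 - q) + (p - 1 - q).factorial * (2 ^ (p + q) * 2 ^ (2 ^ q - 1) + (q + 1) * 2 ^ (2 ^ q - 1)) *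
    (p - 1).choose q + 2 * p

/-- **EVERY LEVEL IS A FINITE PROBLEM MODULO THE LEVEL BELOW — EXPLICITLY** (night-1's
`exists_finite_cells_level_succ` with `Pexp` in place of the existential `P` and `Nexp p (q+1)` in place of the
existential `N`): for `q ≥ 3`, C-025 at level `q + 1` for every finite matroid and every `p ≥ q + 3` follows from
C-025 at level `q` (all `p ≥ q + 2`) together with the simple, coloop-free, `e`-free core cells of rank
`q + 3 ≤ p < Pexp (q + 1)` on fewer than `Nexp p (q + 1)` elements — finitely many matroids up to isomorphism,
with explicit bounds. -/
theorem finite_cells_level_succ_explicit (q : ℕ) (hq : 3 ≤ q)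
    (hprev : ∀ (M : Matroid α) [M.Finite] (p : ℕ), q + 2 ≤ p → RLS M p q)
    (hcells : ∀ (M : Matroid α) [M.Finite] (p : ℕ), q + 3 ≤ p → p < Pexp (q + 1) → M.E.ncard < Nexp p (q + 1) →
      (∀ e ∈ M.E, ∀ f ∈ M.E, e ≠ f → M.eRk {e, f} = 2) → M.eRank = (p : ℕ∞) → (∀ e, ¬ M.IsColoop e) →
      (∀ e ∈ M.E, ∃ A ⊆ M.E \ {e}, e ∉ M.closure A ∧ e ∉ M.closure ((M.E \ {e}) \ A)) → RLS M p (q + 1)) :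
    ∀ (M : Matroid α) [M.Finite] (p : ℕ), q + 3 ≤ p → RLS M p (q + 1) := by
  refine rls_succ_all q hprev ?_
  intro M _ p hp hs hR hc hfree
  rcases Nat.lt_or_ge p (Pexp (q + 1)) with hpP | hpP
  · rcases Nat.lt_or_ge M.E.ncard (Nexp p (q + 1)) with hn | hn
    · exact hcells M p hp hpP hn hs hR hc hfree
    · exact core_fixed_rank_of_le p (q + 1) (by omega) M hn hfree
  · exact c025_explicit_all (q + 1) (by omega) M p hpP

/-- **THE CRUX AT LEVEL `q` IS AN EXPLICIT FINITE LIST OF CORE CELLS** (given the `q = 3` row): if every simple,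
coloop-free, `e`-free core cell `(p, n)` of every level `4 ≤ q' ≤ q` with `q' + 2 ≤ p < Pexp q'` and
`n < Nexp p q'` satisfies C-025 at level `q'`, then C-025 holds at level `q` for every finite matroid and every
`p ≥ q + 2` (`finite_cells_level_succ_explicit` chained from `SevenThree.c025_three_all`). -/
theorem c025_level_of_cells (q : ℕ) (hq : 3 ≤ q)
    (hcells : ∀ q', 4 ≤ q' → q' ≤ q → ∀ (M : Matroid α) [M.Finite] (p : ℕ), q' + 2 ≤ p → p < Pexp q' →
      M.E.ncard < Nexp p q' → (∀ e ∈ M.E, ∀ f ∈ M.E, e ≠ f → M.eRk {e, f} = 2) → M.eRank = (p : ℕ∞) →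
      (∀ e, ¬ M.IsColoop e) →
      (∀ e ∈ M.E, ∃ A ⊆ M.E \ {e}, e ∉ M.closure A ∧ e ∉ M.closure ((M.E \ {e}) \ A)) → RLS M p q') :
    ∀ (M : Matroid α) [M.Finite] (p : ℕ), q + 2 ≤ p → RLS M p q := by
  induction q, hq using Nat.le_induction with
  | base =>
    intro M _ p hp
    exact SevenThree.c025_three_all M p hp
  | succ q hq ih =>
    have ih' := ih (fun q' h4 hq' => hcells q' h4 (by omega))
    intro M _ p hp
    exact finite_cells_level_succ_explicit q hq ih'
      (fun M _ p hp hP hn hs hR hc hfree => hcells (q + 1) (by omega) le_rfl M p hp hP hn hs hR hc hfree) M p hp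

/-- **S4 — every level `q ≥ 7`**: `RLS M p q` for every finite matroid and every `p ≥ Pexp q`. -/
theorem c025_explicit_seven_up (q : ℕ) (hq : 7 ≤ q) (M : Matroid α) [M.Finite] (p : ℕ)
    (hp : Pexp q ≤ p) : RLS M p q :=
  c025_explicit_all q (by omega) M p hp

end ThmN

end PercRepro
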